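import Mathlib
import HarnessLib
import Summits.Parity.Statement
import Summits.Parity.GeneralizedHardyLittlewood.Theses.ShiftTauberian

/-!
# Glue of the Selberg-descent split of `RobustRigidity` (route-Parity-ShiftTauberian rev 1, item stmt-Parity-27493)

`RobustRigidityGlue : SelbergPairs → SelbergTuples → RigidityDescent → RobustRigidity` — pure logic: take `N₀ := max` of
the thresholds of the relevant Selberg piece (`t ≤ 2` or `t ≥ 3`) and of `RigidityDescent`, and feed the centre's
`Sel₂`-instance into the extra hypothesis of `RigidityDescent`.  (Node G2.1 «SelbergDescent», decomp-parity lens-3 g2;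
kernel twin of `SelbergDescent.robustRigidity_of_pieces`.)
-/

namespace Summit.Parity.GeneralizedHardyLittlewood.Theses.ShiftTauberian

/-- Glue item stmt-Parity-27493 of route-Parity-ShiftTauberian rev 1 (node G2.1 «SelbergDescent»):
`SelbergPairs → SelbergTuples → RigidityDescent → RobustRigidity`.  Pure logic — threshold `max N₁ N₂`,
the `t ≤ 2` / `t ≥ 3` dichotomy picks the Selberg piece whose conclusion is the inserted hypothesis of
`RigidityDescent`. -/
theorem robustRigidityGlue_holds : RobustRigidityGlue := by
  intro hP hT hD t L ht ε hε
  obtain ⟨N₂, h₂⟩ := hD t L ht ε hε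
  rcases le_or_gt t 2 with ht2 | ht3
  · obtain ⟨N₁, h₁⟩ := hP t L ht ht2 ε hε
    refine ⟨max N₁ N₂, fun N hN Ψ hΨ hL K hK hKN B hB hcard hgood => ?_⟩
    exact h₂ N (le_trans (le_max_right _ _) hN) Ψ hΨ hL K hK hKN
      (h₁ N (le_trans (le_max_left _ _) hN) Ψ hΨ hL K hK hKN) B hB hcard hgood
  · obtain ⟨N₁, h₁⟩ := hT t L (by omega) ε hε
    refine ⟨max N₁ N₂, fun N hN Ψ hΨ hL K hK hKN B hB hcard hgood => ?_⟩
    exact h₂ N (le_trans (le_max_right _ _) hN) Ψ hΨ hL K hK hKN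
      (h₁ N (le_trans (le_max_left _ _) hN) Ψ hΨ hL K hK hKN) B hB hcard hgood

end Summit.Parity.GeneralizedHardyLittlewood.Theses.ShiftTauberian
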